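import Summits.ResolutionOfSingularities.ResolutionOfSingularities.Theorems.PurelyInseparableDim4WinCertLeafStill
import Summits.ResolutionOfSingularities.ResolutionOfSingularities.Theorems.PurelyInseparableDim4LocalGameTorus
import HarnessLib
import HarnessLib.Audit.Tags

/-!
# Purely inseparable fourfolds — the TORUS IDENTITY for translated presented polynomials
# (core lemmas of TORUS-FLAT absorption in the ∀K certificate format)
# [OURS · counted 0 · elementary algebra for OUR frame-v4 certificate format, not about resolution]

Census cell «res-dim4-pi» (D-0157 DOOR 2), desk WORD #164 (b) «∀K RESIDUE»; seat res-rescue-typ-3 g10.  Design: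
`pub/res-hironaka/plan/rescue/typ-3/v4/g10/notes/TORUS-FLAT-KIND-SPEC.md`; clause text res-dim4 STATUS 06:48Z.

* §1 `translate_monomial_expand` / **`coeff_translate_monomial`**: the multivariate binomial expansion
  `c·(x + v)^e = Σ_{k ≤ e} c·∏ᵢ C(eᵢ,kᵢ) vᵢ^{eᵢ−kᵢ}·x^k` (`boxCoeff`), and its vanishing / factorisation off / on the
  support of `v` (`boxCoeff_eq_zero_of_lt`, `boxCoeff_eq_of_support`);
* §2 **`scale_eq_of_cert`**: from an integer certificate `d·a_u = m_u + Σᵢ kᵢ l_{u,i}` and roots `w_u^d = v_u`, the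
  torus element `μ = ∏ w_u^{m_u}`, `νᵢ = ∏ w_u^{l_{u,i}}` has `μ ∏ νᵢ^{kᵢ} = ∏ v_u^{a_u}`;
* §3 **`clean_translate_eq_torus`**: if every term `(e, c)` of a term list `L` satisfies the certificate for every box
  exponent `k ≤ e` (`k = e` off `W`) that survives cleaning, then for `v` supported on `W`
  `clean (translate_v (L ⊗ K)) = C μ · (clean (translate_{1_W} (L ⊗ K)))(ν x)` — B's translation along the flat is a
  TORUS move on the 𝔽_p-point child.
USE: `…WinCertLeafTorus` (checker `twinCertBL` + soundness).  Nothing here proves resolution of singularities in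
dimension ≥ 4 / characteristic `p`; F4-C(2,2) stays OPEN.  Counted 0; AI work, weaker than expert review.
bears_on: LADDER-RESOLUTION:D157-DOOR2 (res-dim4-pi · F4-C ∀K column · torus-flat core).
Supports stmt-ResolutionOfSingularities-16155 (helper).
-/

set_option linter.dupNamespace false

noncomputable section
open MvPolynomial Finset
open scoped BigOperators
namespace Summit.ResolutionOfSingularities.ResolutionOfSingularities.Theorems.PIDim4

namespace TorusFlat

open Literature.AlgebraicGeometry.Resolution
open Literature.AlgebraicGeometry.Resolution.Hauser2010
open StepKit

variable {K : Type} [Field K]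

/-! ## 1. The translate of a monomial, coefficient by coefficient -/

/-- The coefficient of `x^k` in `(x + v)^e`: `∏ᵢ C(eᵢ, kᵢ) vᵢ^{eᵢ − kᵢ}`. [folklore] -/
def boxCoeff (v : Fin 4 → K) (e k : Fin 4 → ℕ) : K := ∏ i, ((Nat.choose (e i) (k i) : K) * v i ^ (e i - k i))

/-- `Σᵢ single i (k i) = expo k`. [folklore] -/
theorem sum_single_eq_expo (k : Fin 4 → ℕ) : ∑ i, Finsupp.single i (k i) = expo k := by
  have := Finsupp.univ_sum_single (expo k)
  simpa only [expo_apply] using this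

/-- A product of one-variable monomials is a monomial. [folklore] -/
theorem prod_monomial_single (k : Fin 4 → ℕ) (a : Fin 4 → K) :
    ∏ i, (monomial (Finsupp.single i (k i)) (a i) : MvPolynomial (Fin 4) K) = monomial (expo k) (∏ i, a i) := by
  rw [← sum_single_eq_expo]
  induction (Finset.univ : Finset (Fin 4)) using Finset.induction_on with
  | empty => simp
  | insert i s hi ih => rw [Finset.prod_insert hi, Finset.prod_insert hi, Finset.sum_insert hi, ih, monomial_mul]

/-- **Expansion of the translate of a monomial**: `c·(x + v)^e = Σ_{k ≤ e} c·∏ C(eᵢ,kᵢ) vᵢ^{eᵢ−kᵢ} · x^k`. [folklore] -/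
theorem translate_monomial_expand (v : Fin 4 → K) (e : Fin 4 → ℕ) (c : K) :
    PointBlowup.translate v (monomial (expo e) c) =
      ∑ k ∈ Fintype.piFinset (fun i => Finset.range (e i + 1)), monomial (expo k) (c * boxCoeff v e k) := by
  unfold PointBlowup.translate
  rw [aeval_monomial, algebraMap_eq, Finsupp.prod_fintype _ _ (fun i => pow_zero _)]
  simp only [expo_apply]
  have hf : ∀ i, (X i + C (v i) : MvPolynomial (Fin 4) K) ^ e i =
      ∑ m ∈ Finset.range (e i + 1), monomial (Finsupp.single i m) ((Nat.choose (e i) m : K) * v i ^ (e i - m)) := by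
    intro i
    rw [add_pow]
    refine Finset.sum_congr rfl fun m _ => ?_
    rw [X_pow_eq_monomial, ← map_pow, ← map_natCast (C : K →+* MvPolynomial (Fin 4) K), mul_assoc, ← map_mul,
      mul_comm (monomial (Finsupp.single i m) (1 : K)), C_mul_monomial, mul_one, mul_comm (v i ^ (e i - m))]
  simp only [hf]
  rw [Finset.prod_univ_sum, Finset.mul_sum]
  refine Finset.sum_congr rfl fun k _ => ?_
  rw [prod_monomial_single, C_mul_monomial, boxCoeff]

/-- **The coefficient of `x^k` in the translate of a monomial.** [folklore] -/
theorem coeff_translate_monomial (v : Fin 4 → K) (e : Fin 4 → ℕ) (c : K) (k : Fin 4 → ℕ) :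
    coeff (expo k) (PointBlowup.translate v (monomial (expo e) c)) =
      if (∀ i, k i ≤ e i) then c * boxCoeff v e k else 0 := by
  classical
  rw [translate_monomial_expand, coeff_sum]
  simp only [coeff_monomial, expo_inj]
  rw [Finset.sum_ite_eq' (Fintype.piFinset fun i => Finset.range (e i + 1)) k]
  simp only [Fintype.mem_piFinset, Finset.mem_range, Nat.lt_succ_iff]

/-- Off the support of `v`, a surviving box term has `kᵢ = eᵢ`; otherwise the coefficient vanishes. [folklore] -/
theorem boxCoeff_eq_zero_of_lt {v : Fin 4 → K} {e k : Fin 4 → ℕ} {i : Fin 4} (hv : v i = 0) (hlt : k i < e i) :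
    boxCoeff v e k = 0 := by
  unfold boxCoeff
  refine Finset.prod_eq_zero (Finset.mem_univ i) ?_
  rw [hv, zero_pow (Nat.sub_ne_zero_of_lt hlt), mul_zero]

/-- On a box term with `kᵢ = eᵢ` off `W`, the coefficient is `∏ᵢ C(eᵢ,kᵢ) · ∏_{u ∈ W} v_u^{e_u − k_u}`. [folklore] -/
theorem boxCoeff_eq_of_support (v : Fin 4 → K) (W : Finset (Fin 4))
    {e k : Fin 4 → ℕ} (hk : ∀ i, i ∉ W → k i = e i) :
    boxCoeff v e k = (∏ i, (Nat.choose (e i) (k i) : K)) * ∏ u ∈ W, v u ^ (e u - k u) := by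
  classical
  unfold boxCoeff
  rw [Finset.prod_mul_distrib]
  congr 1
  rw [← Finset.prod_subset (Finset.subset_univ W)]
  intro i _ hi
  rw [hk i hi, Nat.sub_self, pow_zero]

/-! ## 2. Scaling data from an exponent certificate -/

/-- The scaling `x ↦ ν x`, `F ↦ μ F` acts on coefficients by `μ ∏ νᵢ^{kᵢ}`. [folklore] -/
theorem coeff_C_mul_scale (μ : K) (ν : Fin 4 → K) (F : MvPolynomial (Fin 4) K) (d : Fin 4 →₀ ℕ) :
    coeff d (C μ * aeval (fun i => C (ν i) * X i) F) = μ * (∏ i, ν i ^ d i) * coeff d F := by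
  rw [coeff_C_mul, Torus.coeff_scale, mul_assoc]

/-- `∏_{u ∈ W} w_u ^ (Σ_{i} a u i) = ∏ i, ∏_{u ∈ W} w_u ^ (a u i)` for integer exponents. [folklore] -/
theorem prod_zpow_sum {W : Finset (Fin 4)} {w : Fin 4 → K} (hw : ∀ u ∈ W, w u ≠ 0) (a : Fin 4 → Fin 4 → ℤ) :
    ∏ u ∈ W, w u ^ (∑ i, a u i) = ∏ i, ∏ u ∈ W, w u ^ a u i := by
  rw [Finset.prod_comm]
  refine Finset.prod_congr rfl fun u hu => ?_
  induction (Finset.univ : Finset (Fin 4)) using Finset.induction_on with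
  | empty => simp
  | insert i s hi ih => rw [Finset.sum_insert hi, Finset.prod_insert hi, zpow_add₀ (hw u hu), ih]

/-- **The torus element of a certificate**: given `d ≥ 1`, roots `w_u^d = v_u` (`u ∈ W`), integers `m_u`, `l_{u,i}`
with `d·a_u = m_u + Σᵢ kᵢ l_{u,i}`, the scalars `μ = ∏ w_u^{m_u}`, `νᵢ = ∏ w_u^{l_{u,i}}` satisfy
`μ ∏ᵢ νᵢ^{kᵢ} = ∏_{u∈W} v_u^{a_u}`. [folklore] -/
theorem scale_eq_of_cert {W : Finset (Fin 4)} {v w : Fin 4 → K} {d : ℕ} (hw : ∀ u ∈ W, w u ^ d = v u)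
    (hw0 : ∀ u ∈ W, w u ≠ 0) (m : Fin 4 → ℤ) (l : Fin 4 → Fin 4 → ℤ) (k a : Fin 4 → ℕ)
    (hcert : ∀ u ∈ W, (d : ℤ) * a u = m u + ∑ i, (k i : ℤ) * l u i) :
    (∏ u ∈ W, w u ^ m u) * ∏ i, (∏ u ∈ W, w u ^ l u i) ^ k i = ∏ u ∈ W, v u ^ a u := by
  -- rewrite the right-hand side with the roots
  have hr : ∏ u ∈ W, v u ^ a u = ∏ u ∈ W, w u ^ ((d : ℤ) * a u) := by
    refine Finset.prod_congr rfl fun u hu => ?_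
    rw [← hw u hu, zpow_mul, zpow_natCast, zpow_natCast, ← pow_mul]
  rw [hr]
  have hl : ∏ i, (∏ u ∈ W, w u ^ l u i) ^ k i = ∏ u ∈ W, w u ^ (∑ i, (k i : ℤ) * l u i) := by
    rw [prod_zpow_sum hw0]
    refine Finset.prod_congr rfl fun i _ => ?_
    rw [← zpow_natCast, ← Finset.prod_zpow]
    refine Finset.prod_congr rfl fun u hu => ?_
    rw [← zpow_mul, mul_comm]
  rw [hl, ← Finset.prod_mul_distrib]
  refine Finset.prod_congr rfl fun u hu => ?_
  rw [← zpow_add₀ (hw0 u hu), hcert u hu]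

/-! ## 3. The torus identity for a translated term list -/

/-- The indicator point of `W`: `1` on `W`, `0` elsewhere. [folklore] -/
def oneOn (W : Finset (Fin 4)) : Fin 4 → K := fun i => if i ∈ W then 1 else 0

/-- **Termwise torus identity**: for a term `(e, c)` whose box terms `k` (`k ≤ e`, `k = e` off `W`, `k` not a `q`-th
power exponent) all satisfy the certificate, the coefficient of `x^k` of the translate by `v` (supported on `W`,
`w_u^d = v_u`) is `μ ν^k` times the coefficient of the translate by the indicator point of `W`. [folklore] -/
theorem coeff_translate_monomial_torus {q : ℕ} {W : Finset (Fin 4)} {v w : Fin 4 → K} {d : ℕ}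
    (hvW : ∀ i, i ∉ W → v i = 0) (hw : ∀ u ∈ W, w u ^ d = v u) (hw0 : ∀ u ∈ W, w u ≠ 0)
    (m : Fin 4 → ℤ) (l : Fin 4 → Fin 4 → ℤ) (e : Fin 4 → ℕ) (c : K)
    (hcert : ∀ k : Fin 4 → ℕ, (∀ i, k i ≤ e i) → (∀ i, i ∉ W → k i = e i) → ¬ IsPthPowerExponent q (expo k) →
      ∀ u ∈ W, (d : ℤ) * ((e u - k u : ℕ) : ℤ) = m u + ∑ i, (k i : ℤ) * l u i)
    (k : Fin 4 → ℕ) (hk : ¬ IsPthPowerExponent q (expo k)) :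
    coeff (expo k) (PointBlowup.translate v (monomial (expo e) c)) =
      (∏ u ∈ W, w u ^ m u) * (∏ i, (∏ u ∈ W, w u ^ l u i) ^ k i) *
        coeff (expo k) (PointBlowup.translate (oneOn W) (monomial (expo e) c)) := by
  classical
  rw [coeff_translate_monomial, coeff_translate_monomial]
  by_cases hle : ∀ i, k i ≤ e i
  · rw [if_pos hle, if_pos hle]
    by_cases hoff : ∀ i, i ∉ W → k i = e i
    · rw [boxCoeff_eq_of_support v W hoff, boxCoeff_eq_of_support (oneOn W) W hoff]
      have h1 : ∏ u ∈ W, (oneOn W : Fin 4 → K) u ^ (e u - k u) = 1 :=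
        Finset.prod_eq_one fun u hu => by rw [oneOn, if_pos hu, one_pow]
      rw [h1, mul_one, scale_eq_of_cert hw hw0 m l k (fun u => e u - k u) (hcert k hle hoff hk)]
      ring
    · push Not at hoff
      obtain ⟨i, hiW, hne⟩ := hoff
      have hlt : k i < e i := lt_of_le_of_ne (hle i) hne
      rw [boxCoeff_eq_zero_of_lt (hvW i hiW) hlt, boxCoeff_eq_zero_of_lt (by rw [oneOn, if_neg hiW]) hlt,
        mul_zero, mul_zero]
  · rw [if_neg hle, if_neg hle, mul_zero]

variable {k₀ : Type} [Field k₀]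

/-- **The torus identity for a translated presented polynomial** (coefficient form): if EVERY term of `L` satisfies
the certificate, then for every exponent `k` that survives cleaning, the coefficient of `x^k` in the translate by
`v` is `μ ν^k` times that of the translate by the indicator point of `W`. [folklore] -/
theorem coeff_translate_evalT_torus {q : ℕ} {W : Finset (Fin 4)} {v w : Fin 4 → K} {d : ℕ} (f : k₀ →+* K)
    (hvW : ∀ i, i ∉ W → v i = 0) (hw : ∀ u ∈ W, w u ^ d = v u) (hw0 : ∀ u ∈ W, w u ≠ 0)
    (m : Fin 4 → ℤ) (l : Fin 4 → Fin 4 → ℤ) :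
    ∀ L : Terms 4 k₀, (∀ t ∈ L, ∀ k : Fin 4 → ℕ, (∀ i, k i ≤ t.1 i) → (∀ i, i ∉ W → k i = t.1 i) →
        ¬ IsPthPowerExponent q (expo k) → ∀ u ∈ W, (d : ℤ) * ((t.1 u - k u : ℕ) : ℤ) = m u + ∑ i, (k i : ℤ) * l u i) →
      ∀ k : Fin 4 → ℕ, ¬ IsPthPowerExponent q (expo k) →
        coeff (expo k) (PointBlowup.translate v (MvPolynomial.map f (evalT L))) =
          (∏ u ∈ W, w u ^ m u) * (∏ i, (∏ u ∈ W, w u ^ l u i) ^ k i) *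
            coeff (expo k) (PointBlowup.translate (oneOn W) (MvPolynomial.map f (evalT L)))
  | [], _, k, _ => by
    unfold PointBlowup.translate
    rw [evalT_nil, map_zero, map_zero, map_zero, coeff_zero, mul_zero]
  | t :: L, hL, k, hk => by
    have ht := hL t List.mem_cons_self
    have hL' := fun t' ht' => hL t' (List.mem_cons_of_mem _ ht')
    have ih := coeff_translate_evalT_torus f hvW hw hw0 m l L hL' k hk
    unfold PointBlowup.translate at ih ⊢
    rw [evalT_cons, map_add, map_monomial, map_add, map_add, coeff_add, coeff_add, ih, mul_add]
    congr 1
    exact coeff_translate_monomial_torus hvW hw hw0 m l t.1 (f t.2) ht k hk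

/-- **THE TORUS IDENTITY**: under the certificate, `clean (translate v G) = μ · (clean (translate 1_W G))(ν x)`.
[folklore] -/
theorem clean_translate_eq_torus {q : ℕ} {W : Finset (Fin 4)} {v w : Fin 4 → K} {d : ℕ} (f : k₀ →+* K)
    (hvW : ∀ i, i ∉ W → v i = 0) (hw : ∀ u ∈ W, w u ^ d = v u) (hw0 : ∀ u ∈ W, w u ≠ 0)
    (m : Fin 4 → ℤ) (l : Fin 4 → Fin 4 → ℤ) (L : Terms 4 k₀)
    (hL : ∀ t ∈ L, ∀ k : Fin 4 → ℕ, (∀ i, k i ≤ t.1 i) → (∀ i, i ∉ W → k i = t.1 i) →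
        ¬ IsPthPowerExponent q (expo k) → ∀ u ∈ W, (d : ℤ) * ((t.1 u - k u : ℕ) : ℤ) = m u + ∑ i, (k i : ℤ) * l u i) :
    deletePthPowers q (PointBlowup.translate v (MvPolynomial.map f (evalT L))) =
      C (∏ u ∈ W, w u ^ m u) * aeval (fun i => C (∏ u ∈ W, w u ^ l u i) * X i)
        (deletePthPowers q (PointBlowup.translate (oneOn W) (MvPolynomial.map f (evalT L)))) := by
  classical
  rw [← Torus.deletePthPowers_scale, ← Torus.deletePthPowers_C_mul]
  ext dd
  rw [coeff_deletePthPowers, coeff_deletePthPowers]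
  split_ifs with hp
  · rfl
  · rw [coeff_C_mul_scale, ← expo_coe dd]
    rw [← expo_coe dd] at hp
    rw [coeff_translate_evalT_torus f hvW hw hw0 m l L hL (⇑dd) hp]
    simp only [expo_apply]

end TorusFlat

end Summit.ResolutionOfSingularities.ResolutionOfSingularities.Theorems.PIDim4

end
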